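import Mathlib
import Summits.ResolutionOfSingularities.ResolutionOfSingularities.Theorems.HomologicalConductorPersistenceCusp34CohomologyAnnihilator
import Summits.ResolutionOfSingularities.ResolutionOfSingularities.Theorems.HomologicalConductorPersistenceKC3LowerFactFree

/-!
# K-C3 §H2L K2-LOWER for the E₆ cDV source `A = k[x,y,z,t]/(xy − z³ − t⁴)`, FACT-FREE (socket S1, producer P-ii)

[OURS · L1 w44b] res-type-011's `PersistenceKC3LowerFactFree.span_le_cohomologyAnnihilator_of_isLocalization_xy_of_le`
/ `…_cusp34_of_le` (K2-LOWER modulo the curve-side bound `hJ`, rev 2 p538364) applied with the fact-free `hJ` of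
`Cusp34.span_sq_map_mk_le_cohomologyAnnihilator_cusp34` (p538802):  for every field `k` with `ringChar k ≠ 2` and `i² = −1`
and EVERY localization `L` of `A = KC3RingXY k (X 0 ^ 3 + X 1 ^ 4)` at the origin,
**`(x̄, ȳ, z̄², z̄t̄, t̄²)·L ⊆ ca(L)`** — no named fact, no hypothesis beyond `char ≠ 2`, `i² = −1`.
NOT a statement of the manuscript under review.
-/

set_option linter.dupNamespace false

noncomputable section

namespace Summit.ResolutionOfSingularities.ResolutionOfSingularities.Theorems.HomologicalConductor.Cusp34

open Literature.RingTheory.CohomologyAnnihilator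
open Summit.ResolutionOfSingularities.ResolutionOfSingularities.Theorems.HomologicalConductor.PersistenceKC3Completion
open Summit.ResolutionOfSingularities.ResolutionOfSingularities.Theorems.HomologicalConductor.PersistenceKC3LowerFactFree

universe u

variable (k : Type u) [Field k]

/-- **K2-LOWER for `xy − z³ − t⁴`, fact-free, at every localization at the origin.** [OURS] -/
theorem span_le_cohomologyAnnihilator_of_isLocalization_cusp34 (hchar : ringChar k ≠ 2) (i : k) (hi : i ^ 2 = -1)
    (L : Type u) [CommRing L] [IsLocalRing L]
    [Algebra (KC3RingXY k (MvPolynomial.X 0 ^ 3 + MvPolynomial.X 1 ^ 4)) L]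
    [(kc3OriginXY k (MvPolynomial.X 0 ^ 3 + MvPolynomial.X 1 ^ 4)).IsPrime]
    [IsLocalization.AtPrime L (kc3OriginXY k (MvPolynomial.X 0 ^ 3 + MvPolynomial.X 1 ^ 4))] :
    Ideal.span {algebraMap (KC3RingXY k (MvPolynomial.X 0 ^ 3 + MvPolynomial.X 1 ^ 4)) L
          (Ideal.Quotient.mk _ (MvPolynomial.X 0)),
        algebraMap (KC3RingXY k (MvPolynomial.X 0 ^ 3 + MvPolynomial.X 1 ^ 4)) L
          (Ideal.Quotient.mk _ (MvPolynomial.X 1)),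
        algebraMap (KC3RingXY k (MvPolynomial.X 0 ^ 3 + MvPolynomial.X 1 ^ 4)) L
          (Ideal.Quotient.mk _ (MvPolynomial.X 2 ^ 2)),
        algebraMap (KC3RingXY k (MvPolynomial.X 0 ^ 3 + MvPolynomial.X 1 ^ 4)) L
          (Ideal.Quotient.mk _ (MvPolynomial.X 2 * MvPolynomial.X 3)),
        algebraMap (KC3RingXY k (MvPolynomial.X 0 ^ 3 + MvPolynomial.X 1 ^ 4)) L
          (Ideal.Quotient.mk _ (MvPolynomial.X 3 ^ 2))} ≤
      cohomologyAnnihilator L :=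
  span_le_cohomologyAnnihilator_of_isLocalization_cusp34_of_le k hchar i hi
    (span_sq_map_mk_le_cohomologyAnnihilator_cusp34 k) L

/-- **K2-LOWER for `xy − z³ − t⁴` at the standard local ring `Localization.AtPrime 𝔬`**, fact-free. [OURS] -/
theorem span_le_cohomologyAnnihilator_localizationAtPrime_cusp34 (hchar : ringChar k ≠ 2) (i : k) (hi : i ^ 2 = -1) :
    haveI := kc3OriginXY_isPrime (constantCoeff_cusp34_poly k)
    Ideal.span {algebraMap (KC3RingXY k (MvPolynomial.X 0 ^ 3 + MvPolynomial.X 1 ^ 4))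
          (Localization.AtPrime (kc3OriginXY k (MvPolynomial.X 0 ^ 3 + MvPolynomial.X 1 ^ 4)))
          (Ideal.Quotient.mk _ (MvPolynomial.X 0)),
        algebraMap (KC3RingXY k (MvPolynomial.X 0 ^ 3 + MvPolynomial.X 1 ^ 4))
          (Localization.AtPrime (kc3OriginXY k (MvPolynomial.X 0 ^ 3 + MvPolynomial.X 1 ^ 4)))
          (Ideal.Quotient.mk _ (MvPolynomial.X 1)),
        algebraMap (KC3RingXY k (MvPolynomial.X 0 ^ 3 + MvPolynomial.X 1 ^ 4))
          (Localization.AtPrime (kc3OriginXY k (MvPolynomial.X 0 ^ 3 + MvPolynomial.X 1 ^ 4)))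
          (Ideal.Quotient.mk _ (MvPolynomial.X 2 ^ 2)),
        algebraMap (KC3RingXY k (MvPolynomial.X 0 ^ 3 + MvPolynomial.X 1 ^ 4))
          (Localization.AtPrime (kc3OriginXY k (MvPolynomial.X 0 ^ 3 + MvPolynomial.X 1 ^ 4)))
          (Ideal.Quotient.mk _ (MvPolynomial.X 2 * MvPolynomial.X 3)),
        algebraMap (KC3RingXY k (MvPolynomial.X 0 ^ 3 + MvPolynomial.X 1 ^ 4))
          (Localization.AtPrime (kc3OriginXY k (MvPolynomial.X 0 ^ 3 + MvPolynomial.X 1 ^ 4)))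
          (Ideal.Quotient.mk _ (MvPolynomial.X 3 ^ 2))} ≤
      cohomologyAnnihilator (Localization.AtPrime (kc3OriginXY k (MvPolynomial.X 0 ^ 3 + MvPolynomial.X 1 ^ 4))) :=
  span_le_cohomologyAnnihilator_localizationAtPrime_xy_of_le k hchar i hi (MvPolynomial.X 0 ^ 3 + MvPolynomial.X 1 ^ 4)
    (constantCoeff_cusp34_poly k) (cusp34_poly_ne_zero k) (span_sq_map_mk_le_cohomologyAnnihilator_cusp34_poly k)

end Summit.ResolutionOfSingularities.ResolutionOfSingularities.Theorems.HomologicalConductor.Cusp34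

end
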